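/-
Origin: expansion seat `planner-pub-hodgecm-mc-axioms-1-g14-0`, handover #W91 2026-08-20T15:53:55Z md5 9a9eaad758c5 (PKG f8d6981f4862 → 9a9eaad758c5; 330 l.; MECHANICAL (iib-R) rewrite v3.1 of the PKG file as it stands (12 token edits; rules R1x1+RX[h₂']x11)) (`HOME/mc/pub-hodgecm-mc-axioms-1-g14/revendor/kit-r55/stage55/HodgeCM/Model/ArchKTypeOfFrame.lean`, md5 9a9eaad758c5, 330 lines);
landed by the gen-22 packager (p-g22) in gate run 55 REPLACES the earlier landed copy of `HodgeCM/Model/ArchKTypeOfFrame.lean` (seat copy carried the packager Origin header of an earlier run (stripped)).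
-/
/-
Copyright (c) 2026. Released under Apache 2.0 license as described in the file LICENSE.
Cell pub-hodgecm, MODEL layer (construction prover mc-carch-1, gen 0), BINDER-OWNERS rows 12/14/15 (`C` / `hpd` / `hk`) — model
item (T-j) at the pin: the BLOCK TRANSPORT `τ` between the adelic archimedean factor `𝓢((Fin n → L⁺_∞), ℂ)` and the block frame of
`Model/HypCensus/ArchDatumBlockCM`, the harmonic family it induces, and E's (AN)/(REP) binders for the honest-pin term
`Model/ArchKTypeOf.archKTypeOf` reduced to BRICK 4 (`Model/ArchKTypeJunction` § 2).
-/
import Summits.HodgeConjecture.HodgeCM.Model.ArchKTypeOf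
import Summits.HodgeConjecture.HodgeCM.Model.ArchKTypeJunction
import Summits.HodgeConjecture.HodgeCM.Model.HypCensus.ArchDatumBlockCM

/-!
# The block transport `τ`, the harmonic family through it, and `hpd` / `hk` of `archKTypeOf` from BRICK 4

BRICK 4 (`ArchKTypeData.isWeaklyPDiff_of_blockPair` / `isPMinusKilledAlong_of_blockPair`, theta-3) proves E's one-sided binders
(AN) `hpd` and (REP) `hk` for ANY archimedean `K`-type datum `B` whose archimedean action and harmonic family are INTERTWINED with
a block pair: `hτ : B.ωinf (e b) (τ x) = τ (ω (s (u21FrameEquiv (expP b), 1)) x)` and `hΦ : B.Φarch ℓ = τ (Φ₁ ℓ ⊠ Φ₂)`.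
binder-2/discharge-3 built the block pair of the CM pin (`HypCensus/ArchDatumBlockCM`: `cmBlockRep` = `cmArchWeilRep` transported by
`cmBigFrame`, `cmBlockSplit`, `cmBlockRelabel`; `isArchWeilDatum_cmBlock` = `hW`, `continuous_cmBlockRep` = `hc`, `cmBlockSection` = `s`,
`continuous_cmBlockSection`, `coe_cmBlockPhaseHom_cmBlockSection` = `hs`).  This file supplies the remaining GLUE for the term
`archKTypeOf` of `Model/ArchKTypeOf`:

* § 1 **`cmBlockTransport … eP eQ : 𝓢((Fin n → L⁺_∞), ℂ) ≃L[ℂ] 𝓢(ℝ^{DPIdx (Fin 2) Unit R S ⊕ σ₂})`** — the composite of the three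
  `schwartzTransport`s behind `cmBlockRep`, with `cmBlockRep_apply_eq` (`cmBlockRep g = τ⁻¹ ∘ cmArchWeilRep g ∘ τ`, definitional) and
  **`cmArchWeilRep_cmBlockTransport_symm : cmArchWeilRep g (τ x) = τ (cmBlockRep g x)`** for `τ := (cmBlockTransport …).symm` — the
  intertwining identity `hτ` needs;
* § 2 **`blockFamilyOf … Φ₁ Φ₂ : (Fin 2 → ℂ)^∨ →ₗ[ℂ] 𝓢((Fin n → L⁺_∞), ℂ)`**, `ℓ ↦ τ (Φ₁ ℓ ⊠ Φ₂)` for a LINEAR local family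
  `Φ₁ : (Fin 2 → ℂ)^∨ →ₗ 𝓢(ℝ^{DPIdx (Fin 2) Unit R S})` (the junction's degree-one harmonics, tree `SchwartzDegreeOneKTypes.degOneP`)
  and a vector `Φ₂` at the other coordinates (the Gaussians at the definite places): `hΦ` holds by `rfl` (`blockFamilyOf_apply`);
* § 3 **`isWeaklyPDiff_archKTypeOf_blockPair`** / **`isPMinusKilledAlong_archKTypeOf_blockPair`** — for the honest-pin term
  `archKTypeOf … ωA … (blockFamilyOf … Φ₁ Φ₂) …` E's `hpd` and `hk` (at `e := expP`) follow from: binder-2's sign facts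
  (`h₁V h₁W hV hW`, the hypotheses of `isArchWeilDatum_cmBlock` verbatim), theta-1's small datum `hW₁ hc₁ hvac₁`, the harmonicity
  relations `hf` of `Φ₁` (REP only), and ONE remaining junction
  **`hωA : ∀ b, ωA (ec b) = cmArchWeilRep hGR (cmBlockSection eP eQ (u21FrameEquiv (expP b), 1))`** along a chart `ec`
  (E's `expP`, or `expP ∘ embTwist` — see the TWIST NOTE in § 3) — «the archimedean
  factor along the chart IS the big datum along the block section» = frame matching (J-x₀) between #1097's `ι₁`-section in the
  rational CM frame (`Model/ArchKTypeOfArch.archSectionFrameOf`) and binder-2's `cmBlockSection`, plus triviality of the line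
  scalar `c_k` on `exp 𝔭` (`map_expP_eq_one`).

Nothing is cited and nothing is minted: one `ContinuousLinearEquiv`, one `LinearMap`, kernel lemmas; 0 records, 0 `def … : Prop`.
-/

set_option autoImplicit false

noncomputable section

open Filter Topology Complex
open NumberField NumberField.InfinitePlace NumberField.mixedEmbedding IsDedekindDomain MeasureTheory
open scoped Matrix Classical TensorProduct SchwartzMap
open MulAction
open Literature.Geometry.ComplexHyperbolic.BallModel
open Literature.NumberTheory.Automorphic Literature.NumberTheory.Weil1964
open Literature.AlgebraicGeometry.HodgeTheory
open Literature.AlgebraicGeometry.ShimuraVarieties Literature.AlgebraicGeometry.ShimuraVarieties.BallForms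
open Literature.RepresentationTheory.HeisenbergGroup (polar Heisenberg symplecticGroup ofSymplectic)
open Literature.RepresentationTheory.KonnoKonno2007 Literature.RepresentationTheory.KonnoKonno2007.RealDualPair
open Literature.NumberTheory.GelbartRogawski1991 Literature.NumberTheory.GelbartRogawski1991.UnitaryDualPair
open Literature.Analysis.SegalBargmann Literature.Analysis.Distribution
open Literature.NumberTheory.Automorphic.PicardCM
open HodgeCM.Model.SupplyInstance HodgeCM.Model.SupplyResidual HodgeCM.Model.ThetaSpace
open HodgeCM.Model.HypCensus

namespace HodgeCM
namespace Model

/-! ### § 1. The block transport -/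

section Transport

variable (L : Type) [Field L] [NumberField L] [IsCMField L] {N M n : ℕ} (e : Fin N × Fin M ≃ Fin n)
variable (dV : Fin N → L) (hdV : ∀ i, IsCMField.complexConj L (dV i) = dV i) (hdV0 : ∀ i, dV i ≠ 0)
variable (dW : Fin M → L) (hdW : ∀ i, IsCMField.complexConj L (dW i) = dW i) (hdW0 : ∀ i, dW i ≠ 0)
variable (hGR : (cmSplittingDatum L e dV hdV hdV0 dW hdW hdW0).CompatibleSplitting) (ι₁ : L →+* ℂ)
variable (eP : PosIdx (cmXV L dV hdV ι₁ (cmPlace L ι₁)) ≃ Fin 2) (eQ : NegIdx (cmXV L dV hdV ι₁ (cmPlace L ι₁)) ≃ Unit)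

/-- **The block transport `τ⁻¹`**: `𝓢((Fin n → L⁺ ⊗ ℝ), ℂ) ≃L[ℂ] 𝓢(ℝ^{DPIdx (Fin 2) Unit R S ⊕ (Fin n × {v ≠ v(ι₁)})})` — the scaled
Folland frame `cmBigFrame`, the split at the place under `ι₁` (`cmBlockSplit`) and the `V`-side relabelling (`cmBlockRelabel`), on
Schwartz functions. -/
def cmBlockTransport :
    𝓢((Fin n → mixedSpace (↥(maximalRealSubfield L))), ℂ) ≃L[ℂ]
      SchwartzMap
        (DPIdx (Fin 2) Unit (PosIdx (cmXW L dV dW hdW ι₁ (cmPlace L ι₁))) (NegIdx (cmXW L dV dW hdW ι₁ (cmPlace L ι₁))) ⊕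
          (Fin n × {v : {v : InfinitePlace ↥(maximalRealSubfield L) // v.IsReal} // v ≠ cmPlace L ι₁}) → ℝ) ℂ :=
  ((schwartzTransport (cmBigFrame L e dV hdV hdV0 dW hdW hdW0 ι₁)).trans
      (schwartzTransport (reindexCLE (cmBlockSplit L e dV hdV dW hdW ι₁)))).trans
    (schwartzTransport (reindexCLE (cmBlockRelabel L dV hdV dW hdW ι₁ eP eQ)))

/-- `cmBlockRep g = τ⁻¹ ∘ cmArchWeilRep g ∘ τ` (definitional). -/
theorem cmBlockRep_apply_eq
    (g : UnitaryGroup.arch (↥(maximalRealSubfield L)) L (IsCMField.complexConj L) N (Matrix.diagonal dV) ×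
      UnitaryGroup.arch (↥(maximalRealSubfield L)) L (IsCMField.complexConj L) M (Matrix.diagonal dW))
    (x : SchwartzMap
      (DPIdx (Fin 2) Unit (PosIdx (cmXW L dV dW hdW ι₁ (cmPlace L ι₁))) (NegIdx (cmXW L dV dW hdW ι₁ (cmPlace L ι₁))) ⊕
        (Fin n × {v : {v : InfinitePlace ↥(maximalRealSubfield L) // v.IsReal} // v ≠ cmPlace L ι₁}) → ℝ) ℂ) :
    cmBlockRep L e dV hdV hdV0 dW hdW hdW0 hGR ι₁ eP eQ g x =
      cmBlockTransport L e dV hdV hdV0 dW hdW hdW0 ι₁ eP eQ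
        (cmArchWeilRep L e dV hdV hdV0 dW hdW hdW0 hGR g ((cmBlockTransport L e dV hdV hdV0 dW hdW hdW0 ι₁ eP eQ).symm x)) :=
  rfl

/-- **The intertwining identity**: `cmArchWeilRep g (τ x) = τ (cmBlockRep g x)` for `τ := (cmBlockTransport …).symm`. -/
theorem cmArchWeilRep_cmBlockTransport_symm
    (g : UnitaryGroup.arch (↥(maximalRealSubfield L)) L (IsCMField.complexConj L) N (Matrix.diagonal dV) ×
      UnitaryGroup.arch (↥(maximalRealSubfield L)) L (IsCMField.complexConj L) M (Matrix.diagonal dW))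
    (x : SchwartzMap
      (DPIdx (Fin 2) Unit (PosIdx (cmXW L dV dW hdW ι₁ (cmPlace L ι₁))) (NegIdx (cmXW L dV dW hdW ι₁ (cmPlace L ι₁))) ⊕
        (Fin n × {v : {v : InfinitePlace ↥(maximalRealSubfield L) // v.IsReal} // v ≠ cmPlace L ι₁}) → ℝ) ℂ) :
    cmArchWeilRep L e dV hdV hdV0 dW hdW hdW0 hGR g ((cmBlockTransport L e dV hdV hdV0 dW hdW hdW0 ι₁ eP eQ).symm x) =
      (cmBlockTransport L e dV hdV hdV0 dW hdW hdW0 ι₁ eP eQ).symm (cmBlockRep L e dV hdV hdV0 dW hdW hdW0 hGR ι₁ eP eQ g x) := by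
  rw [cmBlockRep_apply_eq, ContinuousLinearEquiv.symm_apply_apply]

/-! ### § 2. The harmonic family through the block transport -/

/-- **The harmonic family through the block transport**: `ℓ ↦ τ (Φ₁ ℓ ⊠ Φ₂)` for a linear local family `Φ₁` on the junction block
and a vector `Φ₂` at the remaining coordinates (`SchwartzMap.sumProdLeftCLM Φ₂` = `· ⊠ Φ₂`). -/
def blockFamilyOf
    (Φ₁ : Module.Dual ℂ (Fin 2 → ℂ) →ₗ[ℂ]
      SchwartzMap (DPIdx (Fin 2) Unit (PosIdx (cmXW L dV dW hdW ι₁ (cmPlace L ι₁))) (NegIdx (cmXW L dV dW hdW ι₁ (cmPlace L ι₁))) → ℝ) ℂ)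
    (Φ₂ : SchwartzMap ((Fin n × {v : {v : InfinitePlace ↥(maximalRealSubfield L) // v.IsReal} // v ≠ cmPlace L ι₁}) → ℝ) ℂ) :
    Module.Dual ℂ (Fin 2 → ℂ) →ₗ[ℂ] 𝓢((Fin n → mixedSpace (↥(maximalRealSubfield L))), ℂ) where
  toFun ℓ := (cmBlockTransport L e dV hdV hdV0 dW hdW hdW0 ι₁ eP eQ).symm (SchwartzMap.sumProdLeftCLM Φ₂ (Φ₁ ℓ))
  map_add' ℓ ℓ' := by simp only [map_add]
  map_smul' a ℓ := by simp only [map_smul, RingHom.id_apply]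

/-- `hΦ` of BRICK 4 for this family holds by construction. -/
@[simp] theorem blockFamilyOf_apply
    (Φ₁ : Module.Dual ℂ (Fin 2 → ℂ) →ₗ[ℂ]
      SchwartzMap (DPIdx (Fin 2) Unit (PosIdx (cmXW L dV dW hdW ι₁ (cmPlace L ι₁))) (NegIdx (cmXW L dV dW hdW ι₁ (cmPlace L ι₁))) → ℝ) ℂ)
    (Φ₂ : SchwartzMap ((Fin n × {v : {v : InfinitePlace ↥(maximalRealSubfield L) // v.IsReal} // v ≠ cmPlace L ι₁}) → ℝ) ℂ)
    (ℓ : Module.Dual ℂ (Fin 2 → ℂ)) :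
    blockFamilyOf L e dV hdV hdV0 dW hdW hdW0 ι₁ eP eQ Φ₁ Φ₂ ℓ =
      (cmBlockTransport L e dV hdV hdV0 dW hdW hdW0 ι₁ eP eQ).symm (SchwartzMap.sumProdLeftCLM Φ₂ (Φ₁ ℓ)) :=
  rfl

end Transport

/-! ### § 3. E's (AN) `hpd` and (REP) `hk` for the honest-pin term, from BRICK 4

TWIST NOTE (junction (J-x₀) ⇄ (J-arch), recorded 2026-08-19 by carch-1).  #1097's `ι₁`-section `archSectionU21CM L ι₁ V.Hm T hT`
(tree `UnitaryGroupArchSection`, via `archLocalOfEmb ι₁` = `GL₃(embTwist L ι₁)`) writes the component at the place `w(ι₁)` THROUGH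
`embTwist L ι₁` (the identity if Mathlib's `(InfinitePlace.mk ι₁).embedding = ι₁`, entrywise complex conjugation otherwise — which of
the two holds is not decidable: `InfinitePlace.embedding` is `Exists.choose`), whereas binder-2's block frame (`archUForm` = `toUForm ∘
archAt (wOf v) ∘ archPart` in tree `ArchFollandDualPair`, hence `cmBlockSection` / `cmBlockRep`) reads the same component in the RAW place
coordinates.  Consequently the frame matching holds in the form
`archSectionFrameOf V u = (cmBlockSection eP eQ (u21FrameEquiv (GL₃(embTwist L ι₁) u), 1)).1` — NOT with `u` itself — and along
E's chart `GL₃(embTwist)(expP b) = expP (embTwist ∘ b)`.  The theorems below are therefore stated along an ARBITRARY chart `ec`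
with `hωA : ωA (ec b) = cmArchWeilRep (cmBlockSection (u21FrameEquiv (expP b), 1))`: `ec := expP` in the untwisted case,
`ec := expP ∘ (embTwist ∘ ·)` in the twisted one.  (AN) transfers between the two charts trivially (composition with an `ℝ`-linear
automorphism of `ℂ²`); (REP) along `expP ∘ conj` in the direction `-I • e_p` is the `𝔭⁺`- (not `𝔭⁻`-) condition along `expP`, so in
the twisted case the local family `Φ₁` / small datum must be taken in the CONJUGATE orientation — an orientation bookkeeping for the
owners of `Φ₁` (theta-3/theta-2), of the small datum (theta-1) and of the sign convention `h` (glue-1), not a defect of any landed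
statement. -/

section PinJunction

variable (hHD : exists_isReal_hodgeModel) (hI : hodgePQ_independent_of_hodgeModel)
  (h₁ : BallQuotientUniformised)  (h₃ : CMAbelianVarietyRealised)

variable {L : CMField} {ι₁ : L →+* ℂ} {V : HermSpace3 L ι₁} {c : SeesawCtx L}
  (S : ThetaAdelicSide V c) (hV : IsAnisotropic L V.Hm) (k : Fin 4) (N : ℕ) (Γ₀ : Level V)
  (K : Subgroup (UnitaryGroup.finAdelic (↥(maximalRealSubfield L)) L (IsCMField.complexConj L) 3 V.Hm))
  (hK : (satLevelRegimeOf V hV K : Subgroup (V.latticeModel printFact_unitaryCompact_holds).G) ≤ S.Gfin)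
  (hlevel : ∀ δ ∈ levelImage hHD hI h₁ h₃ Γ₀ hV, ∃ x : (V.latticeModel printFact_unitaryCompact_holds).G,
    x ∈ (satLevelRegimeOf V hV K : Subgroup (V.latticeModel printFact_unitaryCompact_holds).G) ∧
      S.ιinf δ * x ∈ (V.latticeModel printFact_unitaryCompact_holds).Γ)
  (hsat : ∀ g ∈ (thetaSpaceInputIn hHD hI h₁ h₃ S hV).KΓ Γ₀,
    g ∈ (satLevelRegimeOf V hV K : Subgroup (V.latticeModel printFact_unitaryCompact_holds).G))
  (ωA : Representation ℂ U21 𝓢((Fin 3 → mixedSpace (↥(maximalRealSubfield L))), ℂ))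
  (hA : ∀ g : U21, (S.P k).ω (S.ιinf g, 1) =
    adelicTensorEnd (K := ↥(maximalRealSubfield L)) (ι := Fin 3) (ωA g) LinearMap.id)

/- the block frame of the pair `(diag dV, diag dW)` of total rank `3` (at the honest `S`: `dV := frameD V`, `dW := lineVec (d k)`) -/
variable {N' M' : ℕ} (e : Fin N' × Fin M' ≃ Fin 3)
  (dV : Fin N' → (L : Type)) (hdV : ∀ i, IsCMField.complexConj (L : Type) (dV i) = dV i) (hdV0 : ∀ i, dV i ≠ 0)
  (dW : Fin M' → (L : Type)) (hdW : ∀ i, IsCMField.complexConj (L : Type) (dW i) = dW i) (hdW0 : ∀ i, dW i ≠ 0)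
  (hGR : (cmSplittingDatum (L : Type) e dV hdV hdV0 dW hdW hdW0).CompatibleSplitting)
  (eP : PosIdx (cmXV (L : Type) dV hdV ι₁ (cmPlace (L : Type) ι₁)) ≃ Fin 2)
  (eQ : NegIdx (cmXV (L : Type) dV hdV ι₁ (cmPlace (L : Type) ι₁)) ≃ Unit)
  (Φ₁ : Module.Dual ℂ (Fin 2 → ℂ) →ₗ[ℂ]
    SchwartzMap (DPIdx (Fin 2) Unit (PosIdx (cmXW (L : Type) dV dW hdW ι₁ (cmPlace (L : Type) ι₁)))
      (NegIdx (cmXW (L : Type) dV dW hdW ι₁ (cmPlace (L : Type) ι₁))) → ℝ) ℂ)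
  (Φ₂ : SchwartzMap ((Fin 3 × {v : {v : InfinitePlace ↥(maximalRealSubfield L) // v.IsReal} // v ≠ cmPlace (L : Type) ι₁}) → ℝ) ℂ)
  (ℓ₀ : Module.Dual ℂ (Fin 2 → ℂ))
  (arch₀ : blockFamilyOf (L : Type) e dV hdV hdV0 dW hdW hdW0 ι₁ eP eQ Φ₁ Φ₂ ℓ₀ = (S.P k).Φinf)
  (hfix : ∀ x : (V.latticeModel printFact_unitaryCompact_holds).G,
    x ∈ (satLevelRegimeOf V hV K : Subgroup (V.latticeModel printFact_unitaryCompact_holds).G) →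
    ∀ ℓ : Module.Dual ℂ (Fin 2 → ℂ),
    (S.P k).ω (x, 1) (testFun (↥(maximalRealSubfield L)) (Fin 3)
        (blockFamilyOf (L : Type) e dV hdV hdV0 dW hdW hdW0 ι₁ eP eQ Φ₁ Φ₂ ℓ) (S.P k).x₀ N) =
      testFun (↥(maximalRealSubfield L)) (Fin 3) (blockFamilyOf (L : Type) e dV hdV hdV0 dW hdW hdW0 ι₁ eP eQ Φ₁ Φ₂ ℓ)
        (S.P k).x₀ N)
  (harm : ∀ (u : ↥(stabilizer U21 x₀)) (ℓ : Module.Dual ℂ (Fin 2 → ℂ)),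
    ωA (u : U21) (blockFamilyOf (L : Type) e dV hdV hdV0 dW hdW hdW0 ι₁ eP eQ Φ₁ Φ₂ ℓ) =
      blockFamilyOf (L : Type) e dV hdV hdV0 dW hdW hdW0 ι₁ eP eQ Φ₁ Φ₂
        ((BallForms.isPullbackCocycle_cotangentCocycle.weightOf x₀).dual u ℓ))

/-- The intertwining identity `hτ` of BRICK 4 for the honest-pin term along a chart `ec : ℂ² → U(2,1)` whose block image is
`u21FrameEquiv (expP b)` (`ec = expP` when the place frame at `w(ι₁)` is read through `ι₁` itself; `ec = expP ∘ conj` when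
Mathlib's `(mk ι₁).embedding` is the conjugate embedding — the `embTwist` of `UnitaryGroupArchSection`), from `hωA`. -/
theorem archKTypeOf_hτ
    (ec : (Fin 2 → ℂ) → U21)
    (hωA : ∀ b : Fin 2 → ℂ, ωA (ec b) =
      cmArchWeilRep (L : Type) e dV hdV hdV0 dW hdW hdW0 hGR
        (cmBlockSection (L : Type) dV hdV hdV0 dW hdW hdW0 ι₁ eP eQ
          (((u21FrameEquiv (expP b) : UForm (Fin 2) Unit),
            (1 : UForm (PosIdx (cmXW (L : Type) dV dW hdW ι₁ (cmPlace (L : Type) ι₁)))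
              (NegIdx (cmXW (L : Type) dV dW hdW ι₁ (cmPlace (L : Type) ι₁))))) :
            Ginf (Fin 2) Unit (PosIdx (cmXW (L : Type) dV dW hdW ι₁ (cmPlace (L : Type) ι₁)))
              (NegIdx (cmXW (L : Type) dV dW hdW ι₁ (cmPlace (L : Type) ι₁))))))
    (b : Fin 2 → ℂ)
    (x : SchwartzMap (DPIdx (Fin 2) Unit (PosIdx (cmXW (L : Type) dV dW hdW ι₁ (cmPlace (L : Type) ι₁)))
      (NegIdx (cmXW (L : Type) dV dW hdW ι₁ (cmPlace (L : Type) ι₁))) ⊕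
        (Fin 3 × {v : {v : InfinitePlace ↥(maximalRealSubfield L) // v.IsReal} // v ≠ cmPlace (L : Type) ι₁}) → ℝ) ℂ) :
    (archKTypeOf hHD hI h₁ h₃ S hV k N Γ₀ K hK hlevel hsat ωA hA
        (blockFamilyOf (L : Type) e dV hdV hdV0 dW hdW hdW0 ι₁ eP eQ Φ₁ Φ₂) ℓ₀ arch₀ hfix harm).ωinf (ec b)
        (((cmBlockTransport (L : Type) e dV hdV hdV0 dW hdW hdW0 ι₁ eP eQ).symm : _ ≃L[ℂ] _) x) =
      ((cmBlockTransport (L : Type) e dV hdV hdV0 dW hdW hdW0 ι₁ eP eQ).symm : _ ≃L[ℂ] _)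
        (cmBlockRep (L : Type) e dV hdV hdV0 dW hdW hdW0 hGR ι₁ eP eQ
          (cmBlockSection (L : Type) dV hdV hdV0 dW hdW hdW0 ι₁ eP eQ
            (((u21FrameEquiv (expP b) : UForm (Fin 2) Unit),
              (1 : UForm (PosIdx (cmXW (L : Type) dV dW hdW ι₁ (cmPlace (L : Type) ι₁)))
                (NegIdx (cmXW (L : Type) dV dW hdW ι₁ (cmPlace (L : Type) ι₁))))) : Ginf (Fin 2) Unit _ _)) x) := by
  rw [archKTypeOf_ωinf_apply, hωA b, cmArchWeilRep_cmBlockTransport_symm]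

set_option backward.isDefEq.respectTransparency false in
/-- **E's (AN) binder `hpd` for the honest-pin term** `archKTypeOf … ωA … (blockFamilyOf … Φ₁ Φ₂) …` along `expP`, from
BRICK 4 over binder-2's block pair: modulo the sign facts, theta-1's small datum with its vacuum line, and the junction `hωA`. -/
theorem isWeaklyPDiff_archKTypeOf_blockPair
    (hs₁V : ∃ i₀ : Fin N', (∀ i, i ≠ i₀ → 0 < (ι₁ (dV i)).re) ∨ ∀ i, i ≠ i₀ → (ι₁ (dV i)).re < 0)
    (hs₁W : (∀ j, 0 < (ι₁ (dW j)).re) ∨ ∀ j, (ι₁ (dW j)).re < 0)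
    (hsV : ∀ τ : L →+* ℂ, InfinitePlace.mk τ ≠ InfinitePlace.mk ι₁ → (∀ i, 0 < (τ (dV i)).re) ∨ ∀ i, (τ (dV i)).re < 0)
    (hsW : ∀ τ : L →+* ℂ, InfinitePlace.mk τ ≠ InfinitePlace.mk ι₁ →
      (∃ j₀ : Fin M', ∀ j, j ≠ j₀ → 0 < (τ (dW j)).re) ∨ ∀ j, (τ (dW j)).re < 0)
    {ω₁ : Representation ℂ
      (Ginf (Fin 2) Unit (PosIdx (cmXW (L : Type) dV dW hdW ι₁ (cmPlace (L : Type) ι₁)))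
        (NegIdx (cmXW (L : Type) dV dW hdW ι₁ (cmPlace (L : Type) ι₁))))
      (SchwartzMap (DPIdx (Fin 2) Unit (PosIdx (cmXW (L : Type) dV dW hdW ι₁ (cmPlace (L : Type) ι₁)))
        (NegIdx (cmXW (L : Type) dV dW hdW ι₁ (cmPlace (L : Type) ι₁))) → ℝ) ℂ)}
    (hW₁ : IsArchWeilDatum
      (ι𝕎 (Fin 2) Unit (PosIdx (cmXW (L : Type) dV dW hdW ι₁ (cmPlace (L : Type) ι₁)))
        (NegIdx (cmXW (L : Type) dV dW hdW ι₁ (cmPlace (L : Type) ι₁)))) ω₁)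
    (hc₁ : ∀ u, Continuous (ω₁ u))
    {ev : VacExponents}
    (hvac₁ : ∀ kk : DPK (Fin 2) Unit (PosIdx (cmXW (L : Type) dV dW hdW ι₁ (cmPlace (L : Type) ι₁)))
        (NegIdx (cmXW (L : Type) dV dW hdW ι₁ (cmPlace (L : Type) ι₁))),
      ω₁ (RealDualPair.κ (Fin 2) Unit _ _ kk) (hermitePi 0) = vacScalar ev kk • hermitePi 0)
    (ec : (Fin 2 → ℂ) → U21)
    (hωA : ∀ b : Fin 2 → ℂ, ωA (ec b) =
      cmArchWeilRep (L : Type) e dV hdV hdV0 dW hdW hdW0 hGR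
        (cmBlockSection (L : Type) dV hdV hdV0 dW hdW hdW0 ι₁ eP eQ
          (((u21FrameEquiv (expP b) : UForm (Fin 2) Unit),
            (1 : UForm (PosIdx (cmXW (L : Type) dV dW hdW ι₁ (cmPlace (L : Type) ι₁)))
              (NegIdx (cmXW (L : Type) dV dW hdW ι₁ (cmPlace (L : Type) ι₁))))) :
            Ginf (Fin 2) Unit (PosIdx (cmXW (L : Type) dV dW hdW ι₁ (cmPlace (L : Type) ι₁)))
              (NegIdx (cmXW (L : Type) dV dW hdW ι₁ (cmPlace (L : Type) ι₁))))))
    :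
    (archKTypeOf hHD hI h₁ h₃ S hV k N Γ₀ K hK hlevel hsat ωA hA
        (blockFamilyOf (L : Type) e dV hdV hdV0 dW hdW hdW0 ι₁ eP eQ Φ₁ Φ₂) ℓ₀ arch₀ hfix harm).IsWeaklyPDiff ec :=
  ArchKTypeData.isWeaklyPDiff_of_blockPair (X := thetaSpaceInputIn hHD hI h₁ h₃ S hV)
    (archKTypeOf hHD hI h₁ h₃ S hV k N Γ₀ K hK hlevel hsat ωA hA
      (blockFamilyOf (L : Type) e dV hdV hdV0 dW hdW hdW0 ι₁ eP eQ Φ₁ Φ₂) ℓ₀ arch₀ hfix harm)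
    (isArchWeilDatum_cmBlock (L : Type) e dV hdV hdV0 dW hdW hdW0 hGR ι₁ eP eQ hs₁V hs₁W hsV hsW)
    (continuous_cmBlockRep (L : Type) e dV hdV hdV0 dW hdW hdW0 hGR ι₁ eP eQ) hW₁ hc₁ hvac₁
    (cmBlockSection (L : Type) dV hdV hdV0 dW hdW hdW0 ι₁ eP eQ)
    (continuous_cmBlockSection (L : Type) dV hdV hdV0 dW hdW hdW0 ι₁ eP eQ)
    (coe_cmBlockPhaseHom_cmBlockSection (L : Type) e dV hdV hdV0 dW hdW hdW0 ι₁ eP eQ) ec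
    ((cmBlockTransport (L : Type) e dV hdV hdV0 dW hdW hdW0 ι₁ eP eQ).symm.toContinuousLinearMap)
    (archKTypeOf_hτ hHD hI h₁ h₃ S hV k N Γ₀ K hK hlevel hsat ωA hA e dV hdV hdV0 dW hdW hdW0 hGR eP eQ Φ₁ Φ₂
      ℓ₀ arch₀ hfix harm ec hωA)
    Φ₂ Φ₁ (fun _ => rfl)

set_option backward.isDefEq.respectTransparency false in
/-- **E's (REP) binder `hk` for the honest-pin term** in the END-STATE shape `∀ p, C.IsPMinusKilledAlong expP (-I • e_p)`, from
BRICK 4 over binder-2's block pair: modulo the sign facts, theta-1's small datum, the junction `hωA`, and the harmonicity relations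
`hf` of the local family `Φ₁` (tree instances: `hypOpGen_add_I_smul_rotBoostGen_degOneP` &c.). -/
theorem isPMinusKilledAlong_archKTypeOf_blockPair
    (hs₁V : ∃ i₀ : Fin N', (∀ i, i ≠ i₀ → 0 < (ι₁ (dV i)).re) ∨ ∀ i, i ≠ i₀ → (ι₁ (dV i)).re < 0)
    (hs₁W : (∀ j, 0 < (ι₁ (dW j)).re) ∨ ∀ j, (ι₁ (dW j)).re < 0)
    (hsV : ∀ τ : L →+* ℂ, InfinitePlace.mk τ ≠ InfinitePlace.mk ι₁ → (∀ i, 0 < (τ (dV i)).re) ∨ ∀ i, (τ (dV i)).re < 0)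
    (hsW : ∀ τ : L →+* ℂ, InfinitePlace.mk τ ≠ InfinitePlace.mk ι₁ →
      (∃ j₀ : Fin M', ∀ j, j ≠ j₀ → 0 < (τ (dW j)).re) ∨ ∀ j, (τ (dW j)).re < 0)
    {ω₁ : Representation ℂ
      (Ginf (Fin 2) Unit (PosIdx (cmXW (L : Type) dV dW hdW ι₁ (cmPlace (L : Type) ι₁)))
        (NegIdx (cmXW (L : Type) dV dW hdW ι₁ (cmPlace (L : Type) ι₁))))
      (SchwartzMap (DPIdx (Fin 2) Unit (PosIdx (cmXW (L : Type) dV dW hdW ι₁ (cmPlace (L : Type) ι₁)))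
        (NegIdx (cmXW (L : Type) dV dW hdW ι₁ (cmPlace (L : Type) ι₁))) → ℝ) ℂ)}
    (hW₁ : IsArchWeilDatum
      (ι𝕎 (Fin 2) Unit (PosIdx (cmXW (L : Type) dV dW hdW ι₁ (cmPlace (L : Type) ι₁)))
        (NegIdx (cmXW (L : Type) dV dW hdW ι₁ (cmPlace (L : Type) ι₁)))) ω₁)
    (hc₁ : ∀ u, Continuous (ω₁ u))
    (ec : (Fin 2 → ℂ) → U21)
    (hωA : ∀ b : Fin 2 → ℂ, ωA (ec b) =
      cmArchWeilRep (L : Type) e dV hdV hdV0 dW hdW hdW0 hGR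
        (cmBlockSection (L : Type) dV hdV hdV0 dW hdW hdW0 ι₁ eP eQ
          (((u21FrameEquiv (expP b) : UForm (Fin 2) Unit),
            (1 : UForm (PosIdx (cmXW (L : Type) dV dW hdW ι₁ (cmPlace (L : Type) ι₁)))
              (NegIdx (cmXW (L : Type) dV dW hdW ι₁ (cmPlace (L : Type) ι₁))))) :
            Ginf (Fin 2) Unit (PosIdx (cmXW (L : Type) dV dW hdW ι₁ (cmPlace (L : Type) ι₁)))
              (NegIdx (cmXW (L : Type) dV dW hdW ι₁ (cmPlace (L : Type) ι₁))))))
    (hf : ∀ (p : Fin 2) (ℓ : Module.Dual ℂ (Fin 2 → ℂ)),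
      hypOpGen (PosIdx (cmXW (L : Type) dV dW hdW ι₁ (cmPlace (L : Type) ι₁)))
          (NegIdx (cmXW (L : Type) dV dW hdW ι₁ (cmPlace (L : Type) ι₁))) p () (Φ₁ ℓ) +
        Complex.I • rotBoostGen (PosIdx (cmXW (L : Type) dV dW hdW ι₁ (cmPlace (L : Type) ι₁)))
          (NegIdx (cmXW (L : Type) dV dW hdW ι₁ (cmPlace (L : Type) ι₁))) p () (Real.pi / 2) (Φ₁ ℓ) = 0) :
    ∀ p : Fin 2,
      (archKTypeOf hHD hI h₁ h₃ S hV k N Γ₀ K hK hlevel hsat ωA hA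
          (blockFamilyOf (L : Type) e dV hdV hdV0 dW hdW hdW0 ι₁ eP eQ Φ₁ Φ₂) ℓ₀ arch₀ hfix harm).IsPMinusKilledAlong ec
        (-Complex.I • (Pi.single p 1 : Fin 2 → ℂ)) :=
  ArchKTypeData.isPMinusKilledAlong_of_blockPair (X := thetaSpaceInputIn hHD hI h₁ h₃ S hV)
    (archKTypeOf hHD hI h₁ h₃ S hV k N Γ₀ K hK hlevel hsat ωA hA
      (blockFamilyOf (L : Type) e dV hdV hdV0 dW hdW hdW0 ι₁ eP eQ Φ₁ Φ₂) ℓ₀ arch₀ hfix harm)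
    (isArchWeilDatum_cmBlock (L : Type) e dV hdV hdV0 dW hdW hdW0 hGR ι₁ eP eQ hs₁V hs₁W hsV hsW)
    (continuous_cmBlockRep (L : Type) e dV hdV hdV0 dW hdW hdW0 hGR ι₁ eP eQ) hW₁ hc₁
    (cmBlockSection (L : Type) dV hdV hdV0 dW hdW hdW0 ι₁ eP eQ)
    (continuous_cmBlockSection (L : Type) dV hdV hdV0 dW hdW hdW0 ι₁ eP eQ)
    (coe_cmBlockPhaseHom_cmBlockSection (L : Type) e dV hdV hdV0 dW hdW hdW0 ι₁ eP eQ) ec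
    ((cmBlockTransport (L : Type) e dV hdV hdV0 dW hdW hdW0 ι₁ eP eQ).symm.toContinuousLinearMap)
    (archKTypeOf_hτ hHD hI h₁ h₃ S hV k N Γ₀ K hK hlevel hsat ωA hA e dV hdV hdV0 dW hdW hdW0 hGR eP eQ Φ₁ Φ₂
      ℓ₀ arch₀ hfix harm ec hωA)
    Φ₂ Φ₁ (fun _ => rfl) hf

end PinJunction

end Model
end HodgeCM

end
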